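import Literature.Probability.RandomPlanarGeometry.HexSAWBrickWallStripFugacitySymmetric
import HarnessLib

/-!
# BBdGDCG 2014 Proposition 6 with BOTH surface fugacities: `μ_T(y,z)` exists, is positive and finite, and `μ_T(y,z) = μ_T(z,y)`

Topic `Literature/Probability/RandomPlanarGeometry` (continues `HexSAWBrickWallStripFugacitySymmetric.lean` — the
two-fugacity partition function `HexBW.stripZ₂ T n y z = C_{T,n}(y,z)` of the brick-wall strip `S_T` over translation
classes, printed one-level weights on both surfaces (`HexBW.bottomVisits₀`: row `0`, odd abscissa; `HexBW.topVisits₀ T`: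
row `T`, `x + T` even), and its exact symmetry `stripZ₂_symm : C_{T,n}(y,z) = C_{T,n}(z,y)` — and
`HexSAWBrickWallStripFugacityLevel0.lean`: the one-variable case `stripZ₀`, `stripMuY₀`).  Source: N. R. Beaton,
M. Bousquet-Mélou, J. de Gier, H. Duminil-Copin, A. J. Guttmann, Comm. Math. Phys. 326 (2014), arXiv:1109.0358v5,
Proposition 6 (p. 10): "For `y, z > 0`, one has `lim A_{T,n}(y,z)^{1/n} = lim B_{T,n}(y,z)^{1/n} = lim C_{T,n}(y,z)^{1/n}
=: μ_T(y,z)`, where `μ_T(y,z)` is finite, and non-decreasing in `y` and `z`. By the symmetry of bridges, `μ_T(y,z) =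
μ_T(z,y)`" (there: "the existence of the limits follows from concatenation and unfolding arguments as given in Section 4
of [JOW06]").  Here, for the `C`-limit over translation classes: weighted sub-multiplicativity (the split vertex is
counted twice in each weight, costing `max(1,y⁻¹) · max(1,z⁻¹)`), Fekete's lemma (Madras–Slade Lemma 1.2.2 p. 9 with
§8.2 (8.2.2)–(8.2.3) p. 267), and the exact symmetry of the previous file.  The arch/bridge limits `A`, `B` and the
monotonicity in `(y,z)` are not treated here (monotonicity is termwise, as in `HexSAWBrickWallStripFugacityLevel0Prop6`).

## Statements (namespace `Literature.Probability.RandomPlanarGeometry.SAW.HexBW`, all PROVED, standard axioms)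

* `topVisits₀_le`, `topVisits₀_split`, `stripZ₂_pos`, `min_pow_le_stripZ₂`;
* **`stripZ₂_add_le`** — `C_{T,N+M}(y,z) ≤ max(1,y⁻¹) max(1,z⁻¹) · C_{T,N}(y,z) · C_{T,M}(y,z)`;
* `stripMuY₂ T y z = μ_T(y,z) := inf_N (max(1,y⁻¹) max(1,z⁻¹) C_{T,N}(y,z))^{1/N}`, `stripMuY₂_le_rpow`,
  **`tendsto_stripZ₂_rpow`** (`C_{T,n}(y,z)^{1/n} → μ_T(y,z)`), `stripMuY₂_pos`;
* **`stripMuY₂_symm : μ_T(y,z) = μ_T(z,y)`**, `stripMuY₂_one_right : μ_T(y,1) = HexBW.stripMuY₀ T y`,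
  `stripMuY₂_one_left : μ_T(1,z) = HexBW.stripMuY₀ T z`.
-/

noncomputable section

open Filter Topology Finset Literature.Probability.LatticeModels Literature.Probability.Percolation SimpleGraph

namespace Literature.Probability.RandomPlanarGeometry.SAW.HexBW

/-! ### Bookkeeping for the top count -/

/-- `topVisits₀ ≤ n + 1`. [cite: BeatonBousquetMelouDeGierDuminilCopinGuttmann2014, §3.2 (arXiv v5 p. 10: tc(ω))] -/
theorem topVisits₀_le (T : ℕ) (a : Site 2) (υ : ℕ → Site 2) (n : ℕ) : topVisits₀ T a υ n ≤ n + 1 := by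
  unfold topVisits₀
  calc ∑ m ∈ Finset.range (n + 1), (if (a + υ m) 1 = (T : ℤ) ∧ ((a + υ m) 0 + T) % 2 = 0 then 1 else 0)
      ≤ ∑ _m ∈ Finset.range (n + 1), 1 := Finset.sum_le_sum fun m _ => by split_ifs <;> omega
    _ = n + 1 := by simp

/-- The top vertices of a walk are those of its two halves, the split vertex (if it is one) counted twice (the
re-normalising translation of `HexBW.split` is horizontal and even, so it preserves the top test).
[cite: BeatonBousquetMelouDeGierDuminilCopinGuttmann2014, Proposition 6 (arXiv v5 p. 10: concatenation)] -/
theorem topVisits₀_split (T : ℕ) (a : Site 2) (ω : ℕ → Site 2) (N M : ℕ) :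
    topVisits₀ T a ω (N + M) + (if (a + ω N) 1 = (T : ℤ) ∧ ((a + ω N) 0 + T) % 2 = 0 then 1 else 0) =
      topVisits₀ T (split N M (a, ω)).1.1 (split N M (a, ω)).1.2 N +
        topVisits₀ T (split N M (a, ω)).2.1 (split N M (a, ω)).2.2 M := by
  unfold topVisits₀ split
  simp only
  have e1 : ∑ m ∈ Finset.range (N + 1),
      (if (a + ω (min m N)) 1 = (T : ℤ) ∧ ((a + ω (min m N)) 0 + T) % 2 = 0 then 1 else 0) =
      ∑ m ∈ Finset.range (N + 1), (if (a + ω m) 1 = (T : ℤ) ∧ ((a + ω m) 0 + T) % 2 = 0 then 1 else 0) :=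
    Finset.sum_congr rfl fun m hm => by rw [min_eq_left (Nat.lt_succ_iff.1 (Finset.mem_range.1 hm))]
  have e2 : ∑ m ∈ Finset.range (M + 1),
      (if (snorm (a + ω N) + (ω (N + min m M) - ω N)) 1 = (T : ℤ) ∧
          ((snorm (a + ω N) + (ω (N + min m M) - ω N)) 0 + T) % 2 = 0 then 1 else 0) =
      ∑ m ∈ Finset.range (M + 1), (if (a + ω (N + m)) 1 = (T : ℤ) ∧ ((a + ω (N + m)) 0 + T) % 2 = 0 then 1 else 0) :=
    Finset.sum_congr rfl fun m hm => by
      rw [min_eq_left (Nat.lt_succ_iff.1 (Finset.mem_range.1 hm))]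
      have h1 : (snorm (a + ω N) + (ω (N + m) - ω N)) 1 = (a + ω (N + m)) 1 := by
        simp only [Pi.add_apply, Pi.sub_apply, snorm_apply_one]; ring
      have h0 : (snorm (a + ω N) + (ω (N + m) - ω N)) 0 = (a 0 + ω N 0) % 2 + (ω (N + m) 0 - ω N 0) := by
        simp only [Pi.add_apply, Pi.sub_apply, snorm_apply_zero]
      have hiff : ((snorm (a + ω N) + (ω (N + m) - ω N)) 1 = (T : ℤ) ∧
            ((snorm (a + ω N) + (ω (N + m) - ω N)) 0 + T) % 2 = 0) ↔
          ((a + ω (N + m)) 1 = (T : ℤ) ∧ ((a + ω (N + m)) 0 + T) % 2 = 0) := by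
        rw [h1, h0]
        simp only [Pi.add_apply]
        constructor
        · rintro ⟨h, h'⟩; exact ⟨h, by omega⟩
        · rintro ⟨h, h'⟩; exact ⟨h, by omega⟩
      exact if_congr hiff rfl rfl
  rw [e1, e2, show N + M + 1 = (N + 1) + M by ring, Finset.sum_range_add, Finset.sum_range_succ' (n := M)]
  simp only [add_zero]
  have e3 : ∀ m, N + 1 + m = N + (m + 1) := fun m => by ring
  simp only [e3]
  ring

/-! ### Positivity and a crude lower bound -/

/-- `0 < C_{T,n}(y,z)` for `y, z > 0`. [cite: BeatonBousquetMelouDeGierDuminilCopinGuttmann2014, §3.2 (arXiv v5 p. 10)] -/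
theorem stripZ₂_pos (T n : ℕ) {y z : ℝ} (hy : 0 < y) (hz : 0 < z) : 0 < stripZ₂ T n y z := by
  unfold stripZ₂
  have hne : (stripPairs T n).Nonempty := Finset.card_pos.1 (one_le_stripCount T n)
  exact Finset.sum_pos (fun p _ => mul_pos (pow_pos hy _) (pow_pos hz _)) hne

/-- `(min(1,y) min(1,z))^{n+1} ≤ C_{T,n}(y,z)` (any single class; both exponents are `≤ n + 1`).
[cite: BeatonBousquetMelouDeGierDuminilCopinGuttmann2014, §3.2 (arXiv v5 p. 10)] -/
theorem min_pow_le_stripZ₂ (T n : ℕ) {y z : ℝ} (hy : 0 < y) (hz : 0 < z) :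
    (min 1 y * min 1 z) ^ (n + 1) ≤ stripZ₂ T n y z := by
  have hne : (stripPairs T n).Nonempty := Finset.card_pos.1 (one_le_stripCount T n)
  obtain ⟨p, hp⟩ := hne
  have hmy : 0 ≤ min 1 y := le_min zero_le_one hy.le
  have hmz : 0 ≤ min 1 z := le_min zero_le_one hz.le
  -- `(min 1 y)^{n+1} ≤ y^b` for `b ≤ n+1`, and similarly for `z`
  have hby : (min 1 y) ^ (n + 1) ≤ y ^ bottomVisits₀ p.1 p.2 n := by
    have hb := bottomVisits₀_le p.1 p.2 n
    rcases le_or_gt 1 y with h1 | h1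
    · rw [min_eq_left h1, one_pow]; exact one_le_pow₀ h1
    · rw [min_eq_right h1.le]; exact pow_le_pow_of_le_one hy.le h1.le hb
  have htz : (min 1 z) ^ (n + 1) ≤ z ^ topVisits₀ T p.1 p.2 n := by
    have ht := topVisits₀_le T p.1 p.2 n
    rcases le_or_gt 1 z with h1 | h1
    · rw [min_eq_left h1, one_pow]; exact one_le_pow₀ h1
    · rw [min_eq_right h1.le]; exact pow_le_pow_of_le_one hz.le h1.le ht
  unfold stripZ₂
  calc (min 1 y * min 1 z) ^ (n + 1) = (min 1 y) ^ (n + 1) * (min 1 z) ^ (n + 1) := mul_pow _ _ _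
    _ ≤ y ^ bottomVisits₀ p.1 p.2 n * z ^ topVisits₀ T p.1 p.2 n :=
        mul_le_mul hby htz (pow_nonneg hmz _) (pow_nonneg hy.le _)
    _ ≤ ∑ q ∈ stripPairs T n, y ^ bottomVisits₀ q.1 q.2 n * z ^ topVisits₀ T q.1 q.2 n :=
        Finset.single_le_sum (f := fun q => y ^ bottomVisits₀ q.1 q.2 n * z ^ topVisits₀ T q.1 q.2 n)
          (fun q _ => mul_nonneg (pow_nonneg hy.le _) (pow_nonneg hz.le _)) hp

/-! ### Submultiplicativity with both weights -/

/-- One weight across a split: if `b + i = b₁ + b₂` with `i ≤ 1` then `y^b ≤ max(1,y⁻¹) · y^{b₁} y^{b₂}`.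
[cite: BeatonBousquetMelouDeGierDuminilCopinGuttmann2014, Proposition 6 (arXiv v5 p. 10: concatenation)] -/
theorem pow_le_yK_mul_of_split {y : ℝ} (hy : 0 < y) {b b₁ b₂ i : ℕ} (hi : i ≤ 1) (e : b + i = b₁ + b₂) :
    y ^ b ≤ yK y * (y ^ b₁ * y ^ b₂) := by
  rw [← pow_add, ← e, pow_add]
  interval_cases i
  · rw [pow_zero, mul_one]
    calc y ^ b = 1 * y ^ b := (one_mul _).symm
      _ ≤ yK y * y ^ b := mul_le_mul_of_nonneg_right (one_le_yK y) (by positivity)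
  · rw [pow_one]
    calc y ^ b = y⁻¹ * (y ^ b * y) := by field_simp
      _ ≤ yK y * (y ^ b * y) := mul_le_mul_of_nonneg_right (inv_le_yK y) (by positivity)

/-- **Submultiplicativity with both surface weights**:
`C_{T,N+M}(y,z) ≤ max(1,y⁻¹) max(1,z⁻¹) · C_{T,N}(y,z) · C_{T,M}(y,z)`.
[cite: MadrasSlade1993, §8.2, (8.2.2)–(8.2.3) (p. 267) and Lemma 1.2.2 (p. 9) — weighted form]
[cite: BeatonBousquetMelouDeGierDuminilCopinGuttmann2014, Proposition 6 (arXiv v5 p. 10: existence of μ_T(y,z) by concatenation)] -/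
theorem stripZ₂_add_le (T N M : ℕ) {y z : ℝ} (hy : 0 < y) (hz : 0 < z) :
    stripZ₂ T (N + M) y z ≤ yK y * yK z * stripZ₂ T N y z * stripZ₂ T M y z := by
  classical
  have hKy := one_le_yK y
  have hKz := one_le_yK z
  set w : ℕ → Site 2 × (ℕ → Site 2) → ℝ := fun n q => y ^ bottomVisits₀ q.1 q.2 n * z ^ topVisits₀ T q.1 q.2 n
    with hw
  have hpt : ∀ p ∈ stripPairs T (N + M), w (N + M) p ≤
      yK y * yK z * (w N (split N M p).1 * w M (split N M p).2) := by
    rintro ⟨a, ω⟩ -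
    have eb := bottomVisits₀_split a ω N M
    have et := topVisits₀_split T a ω N M
    have hb := pow_le_yK_mul_of_split hy (b := bottomVisits₀ a ω (N + M))
      (i := if (a + ω N) 1 = 0 ∧ (a + ω N) 0 % 2 = 1 then 1 else 0) (by split_ifs <;> omega) eb
    have ht := pow_le_yK_mul_of_split hz (b := topVisits₀ T a ω (N + M))
      (i := if (a + ω N) 1 = (T : ℤ) ∧ ((a + ω N) 0 + T) % 2 = 0 then 1 else 0) (by split_ifs <;> omega) et
    simp only [hw]
    calc y ^ bottomVisits₀ a ω (N + M) * z ^ topVisits₀ T a ω (N + M)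
        ≤ (yK y * (y ^ bottomVisits₀ (split N M (a, ω)).1.1 (split N M (a, ω)).1.2 N *
            y ^ bottomVisits₀ (split N M (a, ω)).2.1 (split N M (a, ω)).2.2 M)) *
          (yK z * (z ^ topVisits₀ T (split N M (a, ω)).1.1 (split N M (a, ω)).1.2 N *
            z ^ topVisits₀ T (split N M (a, ω)).2.1 (split N M (a, ω)).2.2 M)) :=
          mul_le_mul hb ht (by positivity) (by positivity)
      _ = _ := by ring
  have hnn : ∀ q ∈ stripPairs T N ×ˢ stripPairs T M, 0 ≤ w N q.1 * w M q.2 := fun q _ => by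
    simp only [hw]; positivity
  calc stripZ₂ T (N + M) y z
      = ∑ p ∈ stripPairs T (N + M), w (N + M) p := rfl
    _ ≤ ∑ p ∈ stripPairs T (N + M), yK y * yK z * (w N (split N M p).1 * w M (split N M p).2) :=
        Finset.sum_le_sum hpt
    _ = yK y * yK z * ∑ q ∈ (stripPairs T (N + M)).image (split N M), w N q.1 * w M q.2 := by
        rw [Finset.mul_sum, Finset.sum_image (split_injOn T N M)]
    _ ≤ yK y * yK z * ∑ q ∈ stripPairs T N ×ˢ stripPairs T M, w N q.1 * w M q.2 := by
        refine mul_le_mul_of_nonneg_left (Finset.sum_le_sum_of_subset_of_nonneg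
          (fun q hq => ?_) fun q hq _ => hnn q hq) (by nlinarith)
        obtain ⟨p, hp, rfl⟩ := Finset.mem_image.1 hq
        exact split_mem hp
    _ = yK y * yK z * (stripZ₂ T N y z * stripZ₂ T M y z) := by
        rw [Finset.sum_product, stripZ₂, stripZ₂, Finset.sum_mul_sum]
    _ = yK y * yK z * stripZ₂ T N y z * stripZ₂ T M y z := by ring

/-! ### The growth rate `μ_T(y,z)` (Proposition 6, existence) and its symmetry -/

/-- **`μ_T(y,z) := inf_N (max(1,y⁻¹) max(1,z⁻¹) C_{T,N}(y,z))^{1/N}`** (equal to `lim C_{T,N}(y,z)^{1/N}`,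
`tendsto_stripZ₂_rpow`). [cite: BeatonBousquetMelouDeGierDuminilCopinGuttmann2014, Proposition 6 (arXiv v5 p. 10: μ_T(y,z) := lim C_{T,n}(y,z)^{1/n})] -/
def stripMuY₂ (T : ℕ) (y z : ℝ) : ℝ := ⨅ n : ℕ, (yK y * yK z * stripZ₂ T (n + 1) y z) ^ (1 / ((n : ℝ) + 1))

/-- `μ_T(y,z) ≤ (max(1,y⁻¹) max(1,z⁻¹) C_{T,n}(y,z))^{1/n}` for `n ≥ 1`. [cite: BeatonBousquetMelouDeGierDuminilCopinGuttmann2014, Proposition 6 (arXiv v5 p. 10)] -/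
theorem stripMuY₂_le_rpow (T : ℕ) {y z : ℝ} (hy : 0 < y) (hz : 0 < z) {n : ℕ} (hn : n ≠ 0) :
    stripMuY₂ T y z ≤ (yK y * yK z * stripZ₂ T n y z) ^ (1 / (n : ℝ)) := by
  obtain ⟨m, rfl⟩ := Nat.exists_eq_succ_of_ne_zero hn
  have hK : 0 ≤ yK y * yK z := mul_nonneg (by linarith [one_le_yK y]) (by linarith [one_le_yK z])
  have hb : BddBelow (Set.range fun m : ℕ => (yK y * yK z * stripZ₂ T (m + 1) y z) ^ (1 / ((m : ℝ) + 1))) :=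
    ⟨0, by
      rintro _ ⟨m, rfl⟩
      exact Real.rpow_nonneg (mul_nonneg hK (stripZ₂_pos T _ hy hz).le) _⟩
  have := ciInf_le hb m
  simpa [stripMuY₂, Nat.cast_succ] using this

/-- **`C_{T,n}(y,z)^{1/n} → μ_T(y,z)`** — Proposition 6, existence of the two-fugacity growth rate, by Fekete's lemma for
`log(max(1,y⁻¹) max(1,z⁻¹) C_{T,n}(y,z))`, subadditive by `stripZ₂_add_le`.
[cite: BeatonBousquetMelouDeGierDuminilCopinGuttmann2014, Proposition 6 (arXiv v5 p. 10: lim C_{T,n}(y,z)^{1/n} =: μ_T(y,z))]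
[cite: MadrasSlade1993, Lemma 1.2.2 (p. 9) with §8.2 (8.2.2)–(8.2.3) (p. 267)] -/
theorem tendsto_stripZ₂_rpow (T : ℕ) {y z : ℝ} (hy : 0 < y) (hz : 0 < z) :
    Tendsto (fun n : ℕ => (stripZ₂ T n y z) ^ (1 / (n : ℝ))) atTop (𝓝 (stripMuY₂ T y z)) := by
  set K : ℝ := yK y * yK z with hKdef
  have hK : 1 ≤ K := by
    rw [hKdef]; nlinarith [one_le_yK y, one_le_yK z]
  have hK0 : 0 < K := by linarith
  have hpos : ∀ n, 0 < K * stripZ₂ T n y z := fun n => mul_pos hK0 (stripZ₂_pos T n hy hz)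
  have hu : Subadditive fun n => Real.log (K * stripZ₂ T n y z) := by
    intro m n
    rw [← Real.log_mul (hpos m).ne' (hpos n).ne']
    apply Real.log_le_log (hpos _)
    have h := stripZ₂_add_le T m n hy hz
    rw [← hKdef] at h
    calc K * stripZ₂ T (m + n) y z ≤ K * (K * stripZ₂ T m y z * stripZ₂ T n y z) :=
          mul_le_mul_of_nonneg_left h hK0.le
      _ = K * stripZ₂ T m y z * (K * stripZ₂ T n y z) := by ring
  set c : ℝ := min 1 y * min 1 z with hc
  have hc0 : 0 < c := mul_pos (lt_min one_pos hy) (lt_min one_pos hz)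
  have hc1 : c ≤ 1 := by
    rw [hc]
    calc min 1 y * min 1 z ≤ 1 * 1 :=
          mul_le_mul (min_le_left _ _) (min_le_left _ _) (le_min zero_le_one hz.le) zero_le_one
      _ = 1 := one_mul 1
  have hbdd : BddBelow (Set.range fun n : ℕ => Real.log (K * stripZ₂ T n y z) / n) := by
    refine ⟨2 * Real.log c, ?_⟩
    rintro _ ⟨n, rfl⟩
    have hlog0 : Real.log c ≤ 0 := Real.log_nonpos hc0.le hc1
    rcases Nat.eq_zero_or_pos n with rfl | hn
    · simp only [Nat.cast_zero, div_zero]; linarith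
    · have h1 : c ^ (n + 1) ≤ K * stripZ₂ T n y z :=
        (min_pow_le_stripZ₂ T n hy hz).trans (le_mul_of_one_le_left (stripZ₂_pos T n hy hz).le hK)
      have h2 : ((n : ℝ) + 1) * Real.log c ≤ Real.log (K * stripZ₂ T n y z) := by
        have := Real.log_le_log (pow_pos hc0 _) h1
        rwa [Real.log_pow, Nat.cast_succ] at this
      rw [le_div_iff₀ (by exact_mod_cast hn)]
      have hn1 : (1 : ℝ) ≤ n := by exact_mod_cast hn
      nlinarith
  have hlim := hu.tendsto_lim hbdd
  have hKlim : Tendsto (fun n : ℕ => K ^ (1 / (n : ℝ))) atTop (𝓝 1) := by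
    have h1 : Tendsto (fun n : ℕ => Real.log K / (n : ℝ)) atTop (𝓝 0) :=
      tendsto_const_div_atTop_nhds_zero_nat _
    have h2 := (Real.continuous_exp.tendsto _).comp h1
    rw [Real.exp_zero] at h2
    refine h2.congr fun n => ?_
    rw [Function.comp_apply, Real.rpow_def_of_pos hK0, mul_one_div]
  have key : ∀ n : ℕ, (K * stripZ₂ T n y z) ^ (1 / (n : ℝ)) = Real.exp (Real.log (K * stripZ₂ T n y z) / n) :=
    fun n => by rw [Real.rpow_def_of_pos (hpos n), mul_one_div]
  have hexp : Tendsto (fun n : ℕ => (K * stripZ₂ T n y z) ^ (1 / (n : ℝ))) atTop (𝓝 (Real.exp hu.lim)) := by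
    rw [show (fun n : ℕ => (K * stripZ₂ T n y z) ^ (1 / (n : ℝ))) =
      fun n => Real.exp (Real.log (K * stripZ₂ T n y z) / n) from funext key]
    exact (Real.continuous_exp.tendsto _).comp hlim
  have hid : Real.exp hu.lim = stripMuY₂ T y z := by
    apply le_antisymm
    · refine le_ciInf fun n => ?_
      have h1 := hu.lim_le_div hbdd (Nat.succ_ne_zero n)
      have h2 := Real.exp_le_exp.2 h1
      rw [← key (n + 1)] at h2
      simpa [Nat.cast_succ, hKdef] using h2
    · refine ge_of_tendsto hexp ?_
      filter_upwards [eventually_ge_atTop 1] with n hn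
      rw [hKdef]
      exact stripMuY₂_le_rpow T hy hz (by omega)
  have hprod : Tendsto (fun n : ℕ => K⁻¹ ^ (1 / (n : ℝ)) * (K * stripZ₂ T n y z) ^ (1 / (n : ℝ))) atTop
      (𝓝 (stripMuY₂ T y z)) := by
    have h1 : Tendsto (fun n : ℕ => K⁻¹ ^ (1 / (n : ℝ))) atTop (𝓝 1) := by
      have := hKlim.inv₀ one_ne_zero
      rw [inv_one] at this
      refine this.congr fun n => ?_
      rw [Real.inv_rpow hK0.le]
    have := h1.mul hexp
    rwa [one_mul, hid] at this
  refine hprod.congr fun n => ?_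
  rw [← Real.mul_rpow (inv_nonneg.2 hK0.le) (hpos n).le, ← mul_assoc, inv_mul_cancel₀ hK0.ne', one_mul]

/-- `0 < μ_T(y,z)` (indeed `≥ (min(1,y) min(1,z))²`). [cite: BeatonBousquetMelouDeGierDuminilCopinGuttmann2014, Proposition 6 (arXiv v5 p. 10)] -/
theorem stripMuY₂_pos (T : ℕ) {y z : ℝ} (hy : 0 < y) (hz : 0 < z) : 0 < stripMuY₂ T y z := by
  set c : ℝ := min 1 y * min 1 z with hc
  have hc0 : 0 < c := mul_pos (lt_min one_pos hy) (lt_min one_pos hz)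
  have hc1 : c ≤ 1 := by
    rw [hc]
    calc min 1 y * min 1 z ≤ 1 * 1 :=
          mul_le_mul (min_le_left _ _) (min_le_left _ _) (le_min zero_le_one hz.le) zero_le_one
      _ = 1 := one_mul 1
  have hK : 1 ≤ yK y * yK z := by nlinarith [one_le_yK y, one_le_yK z]
  have h : c ^ 2 ≤ stripMuY₂ T y z := by
    refine le_ciInf fun n => ?_
    have h1 : c ^ (n + 1 + 1) ≤ yK y * yK z * stripZ₂ T (n + 1) y z :=
      (min_pow_le_stripZ₂ T (n + 1) hy hz).trans (le_mul_of_one_le_left (stripZ₂_pos T _ hy hz).le hK)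
    have h2 : (c ^ (n + 1 + 1)) ^ (1 / ((n : ℝ) + 1)) ≤
        (yK y * yK z * stripZ₂ T (n + 1) y z) ^ (1 / ((n : ℝ) + 1)) :=
      Real.rpow_le_rpow (pow_nonneg hc0.le _) h1 (by positivity)
    refine le_trans ?_ h2
    rw [← Real.rpow_natCast c (n + 1 + 1), ← Real.rpow_mul hc0.le]
    have hexp : ((n + 1 + 1 : ℕ) : ℝ) * (1 / ((n : ℝ) + 1)) ≤ 2 := by
      rw [mul_one_div, div_le_iff₀ (by positivity)]; push_cast; linarith
    calc c ^ 2 = c ^ (2 : ℝ) := by norm_cast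
      _ ≤ c ^ (((n + 1 + 1 : ℕ) : ℝ) * (1 / ((n : ℝ) + 1))) := Real.rpow_le_rpow_of_exponent_ge hc0 hc1 hexp
  exact lt_of_lt_of_le (pow_pos hc0 2) h

/-- **Proposition 6, symmetry of the growth rate: `μ_T(y,z) = μ_T(z,y)`** (here from the exact symmetry of every
`C_{T,n}`). [cite: BeatonBousquetMelouDeGierDuminilCopinGuttmann2014, Proposition 6 (arXiv v5 p. 10: "By the symmetry of bridges, μ_T(y,z) = μ_T(z,y)")] -/
theorem stripMuY₂_symm (T : ℕ) (y z : ℝ) : stripMuY₂ T y z = stripMuY₂ T z y := by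
  unfold stripMuY₂
  simp_rw [stripZ₂_symm T _ y z, mul_comm (yK y) (yK z)]

/-- `μ_T(y,1)` is the one-variable growth rate `HexBW.stripMuY₀ T y` of `HexSAWBrickWallStripFugacityLevel0.lean`.
[cite: BeatonBousquetMelouDeGierDuminilCopinGuttmann2014, Proposition 6 (arXiv v5 p. 10: μ_T(y,1))] -/
theorem stripMuY₂_one_right (T : ℕ) (y : ℝ) : stripMuY₂ T y 1 = stripMuY₀ T y := by
  unfold stripMuY₂ stripMuY₀
  have hK : yK 1 = 1 := by simp [yK]
  simp_rw [hK, mul_one, stripZ₂_one_right]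

/-- **`μ_T(1,y) = μ_T(y,1)`**: the printed top-weighted growth rate of Proposition 7 is `HexBW.stripMuY₀ T y`.
[cite: BeatonBousquetMelouDeGierDuminilCopinGuttmann2014, Proposition 6 (arXiv v5 p. 10: "and so, in particular, μ_T(y,1) = μ_T(1,y)")] -/
theorem stripMuY₂_one_left (T : ℕ) (z : ℝ) : stripMuY₂ T 1 z = stripMuY₀ T z := by
  rw [stripMuY₂_symm, stripMuY₂_one_right]

end Literature.Probability.RandomPlanarGeometry.SAW.HexBW
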